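import Summits.NavierStokesRegularity.NavierStokesRegularity.Theorems.TypeITraceScarL3.Negative.ExteriorBUTypeIProbes
import HarnessLib

/-!
# (F-a′) The ABSTRACT exterior vorticity form of s25-3 fails: a divergence-free, irrotational,
# `|y|⁻²`-decaying field with `‖∂ₛω − Δω‖ ≤ (−s)⁻¹‖ω‖`, null top and `ω ≢ 0`

Negative-lane lemma of the disprover seat `cdisprove-stmt-NavierStokesRegularity-18385` (`--supports` the item;
crux work file `Cruxes/TypeITraceScarL3/Disproof.lean`, §(iii)); companion of `ExteriorBUTypeIProbes` (F-a)/(F-b),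
answering the planner brief `BRIEF-cdisprove-18385.md` §(iii) («`TypeIRateVorticityBU_abstract_false` is a clean
Disproof target»).  The typed s25-3 (`ExteriorVorticityBUTypeI` / the planner's `TypeIRateVorticityBU`) asks: a
classical Navier–Stokes flow on `]−1,0[ × (closedBall 0 R)ᶜ` with `‖U‖ ≤ C/√(−s)`, `‖∇U‖ ≤ K/(−s)` and vorticity
weakly null at the top has `curl U = 0` on a smaller exterior region.  Its ABSTRACT analogue keeps from the
vorticity equation `∂ₛω − Δω = ω·∇U − U·∇ω` only the SIZE of the right-hand side,
`‖∂ₛω − Δω‖ ≤ K(−s)⁻¹‖ω‖ + C(−s)^{−1/2}‖∇ω‖`, and is FALSE even in the class of divergence-free, curl-free fields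
decaying like `|y|⁻²`: `ω(s, y) = √(−s)·D(y)`, `D = ∇Γ` the dipole field (tree `dipoleFlow 1`), has `Δω = 0`,
`∂ₛω = −ω/(2(−s))`, so `‖∂ₛω − Δω‖ = (2(−s))⁻¹‖ω‖`, with `div ω = 0`, `curl ω = 0`, `‖ω‖ ≤ √(−s)/(4π|y|²) → 0`
uniformly as `s → 0⁻`, `ω ≠ 0` everywhere on the slab (`exists_exterior_divFree_irrotational_typeICoeff_nullTop_ne_zero`).
So a proof of the NS form must use the COUPLING `ω = curl U` with the SAME `U` in the coefficients (not just
`div ω = 0` or decay), exactly as the brief's (F-a′) `(−s)^K ∇(1/|x|)` predicts (here `K = 1/2`).  WHAT THIS IS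
NOT: not a statement about Navier–Stokes vorticities; not C1, not Stub C, not NS regularity (neither proved nor
refuted here).  References: L. Escauriaza, G. Seregin, V. Šverák, Russian Math. Surveys 58 (2003), Thm 5.1
(bounded coefficients — contrast) [EscauriazaSereginSverak2003]; J. Serrin, Arch. Rational Mech. Anal. 9 (1962)
[Serrin1962].
-/

noncomputable section

set_option linter.dupNamespace false

namespace Summit.NavierStokesRegularity.NavierStokesRegularity.Theorems.TypeITraceScarL3.Negative

open MeasureTheory Set Function Filter Topology Metric TopologicalSpace
open Literature.Analysis.FluidPDE
open scoped NNReal ENNReal InnerProductSpace RealInnerProductSpace Laplacian ContDiff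

/-- `Δ(√(−s)·D) = 0` off the origin. [folklore] -/
theorem laplacian_dipoleFlow_eq_zero (c s : ℝ) {y : EuclideanSpace ℝ (Fin 3)} (hy : y ≠ 0) :
    Δ (dipoleFlow c s) y = 0 := by
  show Δ ((sqrtAmp c s) • dipole) y = 0
  rw [InnerProductSpace.laplacian_smul _ (contDiffAt_dipole hy), (dipole_identities hy).2.1, smul_zero]

/-- `∂ₛ(√(−s)·D(y)) = −(2√(−s))⁻¹·D(y)` for `s < 0`. [folklore] -/
theorem deriv_dipoleFlow (c : ℝ) {s : ℝ} (hs : s < 0) (y : EuclideanSpace ℝ (Fin 3)) :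
    deriv (fun σ => dipoleFlow c σ y) s = sqrtAmpDeriv c s • dipole y :=
  ((hasDerivAt_sqrtAmp c hs).smul_const (dipole y)).deriv

/-- **(F-a′)** On the exterior slab `]−1,0[ × (closedBall 0 1)ᶜ` the field `ω = √(−s)·D` (tree `dipoleFlow 1`)
is `C²`, divergence-free, irrotational, satisfies the Type-I-coefficient parabolic identity
`‖∂ₛω − Δω‖ = (2(−s))⁻¹‖ω‖ ≤ (−s)⁻¹‖ω‖`, decays like `‖ω(s,y)‖ ≤ √(−s)/(4π‖y‖²) ≤ √(−s)`, tends to `0` as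
`s → 0⁻` at every exterior point, and vanishes NOWHERE on the slab: the abstract exterior vorticity backward
uniqueness with the critical zeroth-order coefficient fails even for divergence-free, curl-free, decaying fields.
[folklore; EscauriazaSereginSverak2003 Thm 5.1 (contrast)] -/
theorem exists_exterior_divFree_irrotational_typeICoeff_nullTop_ne_zero :
    ∃ w : ℝ → EuclideanSpace ℝ (Fin 3) → EuclideanSpace ℝ (Fin 3),
      ContDiffOn ℝ 2 (uncurry w)
        (Ioo (-1 : ℝ) 0 ×ˢ (closedBall (0 : EuclideanSpace ℝ (Fin 3)) 1)ᶜ) ∧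
      (∀ s ∈ Ioo (-1 : ℝ) 0, ∀ y ∈ (closedBall (0 : EuclideanSpace ℝ (Fin 3)) 1)ᶜ,
        VectorCalculus.divergence (w s) y = 0 ∧ curl (w s) y = 0) ∧
      (∀ s ∈ Ioo (-1 : ℝ) 0, ∀ y ∈ (closedBall (0 : EuclideanSpace ℝ (Fin 3)) 1)ᶜ,
        ‖deriv (fun σ => w σ y) s - (Δ (w s)) y‖ = 1 / (2 * (-s)) * ‖w s y‖ ∧
        ‖deriv (fun σ => w σ y) s - (Δ (w s)) y‖ ≤ 1 / (-s) * ‖w s y‖) ∧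
      (∀ s ∈ Ioo (-1 : ℝ) 0, ∀ y ∈ (closedBall (0 : EuclideanSpace ℝ (Fin 3)) 1)ᶜ,
        ‖w s y‖ ≤ Real.sqrt (-s) / (4 * Real.pi * ‖y‖ ^ 2) ∧ ‖w s y‖ ≤ Real.sqrt (-s)) ∧
      (∀ y ∈ (closedBall (0 : EuclideanSpace ℝ (Fin 3)) 1)ᶜ,
        Tendsto (fun s => w s y) (𝓝[<] 0) (𝓝 0)) ∧
      ∀ s ∈ Ioo (-1 : ℝ) 0, ∀ y ∈ (closedBall (0 : EuclideanSpace ℝ (Fin 3)) 1)ᶜ, w s y ≠ 0 := by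
  have hcl := dipoleFlow_isClassical 1 (zero_le_one : (0 : ℝ) ≤ 1)
  have hmem : ∀ s ∈ Ioo (-1 : ℝ) 0, ∀ y ∈ (closedBall (0 : EuclideanSpace ℝ (Fin 3)) 1)ᶜ,
      (s, y) ∈ parabolicExterior 1 := fun s hs y hy =>
    exteriorSlab_subset_parabolicExterior (mk_mem_prod hs hy)
  have hnorm : ∀ y ∈ (closedBall (0 : EuclideanSpace ℝ (Fin 3)) 1)ᶜ, 1 < ‖y‖ := fun y hy => by
    rwa [mem_compl_iff, mem_closedBall, dist_zero_right, not_le] at hy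
  refine ⟨dipoleFlow 1, ?_, ?_, ?_, ?_, ?_, ?_⟩
  · exact (hcl.smooth_velocity.of_le (by norm_cast)).mono exteriorSlab_subset_parabolicExterior
  · intro s hs y hy
    exact ⟨hcl.divFree s y (hmem s hs y hy), curl_dipoleFlow_eq_zero 1 s (hnorm y hy)⟩
  · intro s hs y hy
    have hy1 := hnorm y hy
    have hy0 : y ≠ 0 := by rintro rfl; norm_num at hy1
    have hs0 : 0 < -s := by linarith [hs.2]
    have hsq : 0 < Real.sqrt (-s) := Real.sqrt_pos.2 hs0
    have hD : 0 < ‖dipole y‖ := norm_pos_iff.2 (dipole_ne_zero hy0)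
    have hid : ‖deriv (fun σ => dipoleFlow 1 σ y) s - (Δ (dipoleFlow 1 s)) y‖ =
        1 / (2 * (-s)) * ‖dipoleFlow 1 s y‖ := by
      rw [deriv_dipoleFlow 1 hs.2 y, laplacian_dipoleFlow_eq_zero 1 s hy0, sub_zero, norm_smul,
        show dipoleFlow 1 s y = sqrtAmp 1 s • dipole y from rfl, norm_smul, sqrtAmpDeriv, sqrtAmp,
        Real.norm_eq_abs, Real.norm_eq_abs, abs_neg, one_mul,
        abs_of_pos (by positivity : (0 : ℝ) < 1 / (2 * Real.sqrt (-s))), abs_of_pos hsq]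
      have hss : Real.sqrt (-s) * Real.sqrt (-s) = -s := Real.mul_self_sqrt hs0.le
      set a := Real.sqrt (-s) with ha
      rw [← hss]
      field_simp
    refine ⟨hid, ?_⟩
    rw [hid]
    have hn : 0 ≤ ‖dipoleFlow 1 s y‖ := norm_nonneg _
    have h12 : 1 / (2 * (-s)) ≤ 1 / (-s) := by
      rw [div_le_div_iff₀ (by positivity) hs0]; nlinarith
    exact mul_le_mul_of_nonneg_right h12 hn
  · intro s hs y hy
    have hy1 := hnorm y hy
    have hy0 : y ≠ 0 := by rintro rfl; norm_num at hy1
    have hs0 : 0 < -s := by linarith [hs.2]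
    have h1 : ‖dipoleFlow 1 s y‖ = Real.sqrt (-s) / (4 * Real.pi * ‖y‖ ^ 2) := by
      rw [norm_dipoleFlow 1 hy0, abs_one, one_mul, div_eq_mul_inv]
    refine ⟨h1.le, ?_⟩
    rw [h1, div_le_iff₀ (by positivity)]
    have hπ : 4 ≤ 4 * Real.pi * ‖y‖ ^ 2 := by
      have h3 : (3 : ℝ) < Real.pi := Real.pi_gt_three
      nlinarith [h3, hy1, Real.sqrt_nonneg (-s)]
    nlinarith [Real.sqrt_nonneg (-s), hπ]
  · intro y hy
    have hcont : Continuous fun s : ℝ => dipoleFlow 1 s y :=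
      ((continuous_const.mul (Real.continuous_sqrt.comp continuous_neg)).smul continuous_const)
    have h0 : dipoleFlow 1 0 y = 0 := by
      simp [dipoleFlow, sqrtAmp]
    have := (hcont.tendsto 0)
    rw [h0] at this
    exact this.mono_left nhdsWithin_le_nhds
  · intro s hs y hy
    exact dipoleFlow_ne_zero (c := (1 : ℝ)) one_ne_zero zero_le_one (z := (s, y)) (hmem s hs y hy)

end Summit.NavierStokesRegularity.NavierStokesRegularity.Theorems.TypeITraceScarL3.Negative

end
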